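import Summits.AtomisticToContinuum.BoseEinsteinCondensation.Theorems.BECProbeMassFlowCloudMomentumAtomFixedNAllEnergy
import Summits.AtomisticToContinuum.BoseEinsteinCondensation.Theorems.BECProbeMassFlowCloudMomentumAtomFixedN
import Summits.AtomisticToContinuum.BoseEinsteinCondensation.Theorems.BECProbeMassFlowCloudMomentumAtomFreeZeroMomentum
import Summits.AtomisticToContinuum.BoseEinsteinCondensation.Theorems.BECProbeMassFlowCloudMomentumAtomProjectionTransfer
import HarnessLib

/-!
# The fixed-`N` certificate of crux `BECProbeMassFlow.CloudMomentumAtom` over the WHOLE admissible class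
# (item stmt-AtomisticToContinuum-12310, line `registered`, lead c5)

Lead c4 proved (`…Theorems.BECProbeMassFlowCloudMomentumAtomFixedN`, p165038; `…FixedNCrux`, p165338) that for
INTEGRABLE admissible `v` the registered stub `stub_fidelityForEach` (A′) and the body of the crux hold with
the density threshold allowed to depend on the particle number (`∀ N, ∃ ρ₀(N)` instead of
`∃ ρ₀, ∀ ρ < ρ₀, ∀ᶠ N`). This file removes the integrability hypothesis: the same holds for EVERY repulsive
finite-range `v` — hard cores `⊤·1_{[0,a]}`, hard shells, fat-Cantor `⊤`-sets, non-integrable walls. The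
two energy inputs of c4 that needed `∫ v < ∞` (the Born pinning bound and the constant-state bound
`2E^per ≤ N²L⁻³∫v`) are replaced by the inputs of `…Theorems.BECProbeMassFlowCloudMomentumAtomFixedNAllEnergy`
(p167999): **pinning one of `N + 1` bosons lowers the energy**, `E^per(N) ≤ E_imp(N) ≤ E^per(N+1)`
(`impurityPeriodicGroundStateEnergy_zero_le_succ`, from the zero-momentum attainment/descent of crux
`RecoilTransfer`), and **at fixed particle number the free periodic energy of every admissible `v` is
`o(L⁻²)`** (`exists_periodicGroundStateEnergy_le_div_sq`: the Jastrow bound `LSSY2005_jastrowBound_holds`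
[LSSY2005, Thm. 2.2, (2.19)–(2.31)] with a core-vanishing pair profile). At fixed `N` on a large torus the
whole pinned problem therefore sits within `o(L⁻²)` of `E^per(N)`, below the free Ky Fan gap `2π²/L²`
(`ofReal_sq_le_kyFanTwo_zero`), and c4's clustering argument goes through verbatim.

Results: `endpointFidelity_fixedN_all` (every box `L ≥ L₀(v, ε, N)`), `endpointFidelity_fixedN_all_density`,
`stub_fidelityForEach_fixedN_all` (the registered stub's body with `∀ N, ∃ ρ₀`, all admissible `v`) and
`stub_cloudMomentumAtom_fixedN_all` (the CRUX BODY with `∀ N ≥ 1, ∃ ρ₀(N)`, all admissible `v`). So over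
the entire admissible class the crux `CloudMomentumAtom` differs from a kernel-checked theorem EXACTLY by
the uniformity of `ρ₀` in `N` (the thermodynamic limit at fixed density: the free gap `∼ L⁻²` is `o(ρ)`
along `L = sideLength ρ (N+1)` and must be replaced by healing at `ξ = (8πρa)^{-1/2}`).
-/

noncomputable section

namespace Summit.AtomisticToContinuum.BoseEinsteinCondensation.Cruxes.CloudMomentumAtom.Birth

open MeasureTheory Filter
open scoped ENNReal NNReal BigOperators ComplexConjugate
open Literature.MathematicalPhysics.QuantumManyBody.BoseGas
open Literature.MathematicalPhysics.QuantumManyBody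
open Summit.AtomisticToContinuum.BoseEinsteinCondensation.Cruxes.HardCoreExtension.ThirdLawCurrentFloor

variable {N : ℕ} {L : ℝ}

/-! ### The endpoint fidelity at fixed `N`, every admissible `v` -/

/-- **Fixed-`N` endpoint fidelity on every large torus, for EVERY repulsive finite-range `v`** (hard cores
included). For every `ε > 0` and every `N` there is `L₀` such that on every torus of side `L ≥ L₀` ONE
slack `δ > 0` makes every `δ`-near-minimiser `Φ` of the pinned-scatterer energy and every `δ`-near-minimiser
`Ψ` of the free energy overlap `≥ 1 − ε`. Proof (c4's mechanism with the Born/constant-state inputs replaced):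
choose `L₀` with `E^per(N+1, L) ≤ d := π²ε'/(16L²)` for `L ≥ L₀` (`ε' = min ε 1`;
`exists_periodicGroundStateEnergy_le_div_sq`); then `E^per(N) ≤ E_imp(N) ≤ E^per(N+1) ≤ d`
(`impurityPeriodicGroundStateEnergy_zero_le_succ`), so the free Ky Fan gap is `≥ 2π²/L²`
(`ofReal_sq_le_kyFanTwo_zero`, monotonicity in `v ≥ 0`) and a pinned `d`-near-minimiser is a free
`2d = γε'/16`-near-minimiser; the explicit clustering modulus
(`exists_phase_integral_norm_sub_sq_le_of_kyFanGap_explicit`) and the phase-to-overlap dictionary conclude.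
[folklore] -/
theorem endpointFidelity_fixedN_all :
    ∀ (v : ℝ → ℝ≥0∞), IsRepulsiveFiniteRange v →
      ∀ ε : ℝ, 0 < ε → ∀ N : ℕ, ∃ L₀ : ℝ, 0 < L₀ ∧ ∀ L : ℝ, L₀ ≤ L →
        ∃ δ : ℝ≥0∞, 0 < δ ∧ ∀ Φ Ψ : PeriodicTrialState N L,
          impurityPeriodicEnergy v 0 Φ ≤ impurityPeriodicGroundStateEnergy v N L 0 + δ →
          periodicEnergy v Ψ ≤ periodicGroundStateEnergy v N L + δ →
          ENNReal.ofReal (1 - ε) ≤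
            (‖∫ X in cellN N L, conj (Ψ.ψ X) * Φ.ψ X‖₊ : ℝ≥0∞) ^ 2 := by
  intro v hv ε hε N
  -- WLOG `ε ≤ 1`
  set ε' : ℝ := min ε 1 with hε'
  have hε'0 : 0 < ε' := lt_min hε one_pos
  have hε'1 : ε' ≤ 1 := min_le_right _ _
  have hε'ε : ε' ≤ ε := min_le_left _ _
  have hπ := Real.pi_pos
  -- the torus threshold: `E^per(N+1, L) ≤ (π² ε'/16)/L²` for `L ≥ L₁`
  obtain ⟨L₁, hL₁, HL₁⟩ := exists_periodicGroundStateEnergy_le_div_sq hv (N + 1)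
    (c := Real.pi ^ 2 * ε' / 16) (by positivity)
  refine ⟨max 1 L₁, lt_max_of_lt_left one_pos, fun L hL0 => ?_⟩
  have hL1 : 1 ≤ L := (le_max_left _ _).trans hL0
  have hL : 0 < L := one_pos.trans_le hL1
  set d : ℝ := Real.pi ^ 2 * ε' / (16 * L ^ 2) with hd
  have hd0 : 0 < d := by positivity
  have hsucc : periodicGroundStateEnergy v (N + 1) L ≤ ENNReal.ofReal d := by
    have h := HL₁ L ((le_max_right _ _).trans hL0)
    rwa [hd, ← div_div]
  have himp : impurityPeriodicGroundStateEnergy v N L 0 ≤ ENNReal.ofReal d :=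
    (impurityPeriodicGroundStateEnergy_zero_le_succ hv.1 N L).trans hsucc
  have hE0d : periodicGroundStateEnergy v N L ≤ ENNReal.ofReal d :=
    (periodicGroundStateEnergy_le_impurityPeriodicGroundStateEnergy v N L 0).trans himp
  have hE : periodicGroundStateEnergy v N L ≠ ⊤ := ne_top_of_le_ne_top ENNReal.ofReal_ne_top hE0d
  -- the Ky Fan gap `γ = 2π²/L²`: `2E₀ + 2π²/L² ≤ 2d + 2π²/L² ≤ (2π/L)² ≤ kyFanTwo`
  set γ : ℝ := 2 * Real.pi ^ 2 / L ^ 2 with hγ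
  have hγ0 : 0 < γ := by positivity
  have hgap : 2 * periodicGroundStateEnergy v N L + ENNReal.ofReal γ ≤ kyFanTwo v N L := by
    have h2d : 2 * d + γ ≤ (2 * Real.pi / L) ^ 2 := by
      rw [hd, hγ]
      have hL2 : 0 < L ^ 2 := by positivity
      have hL0 : L ≠ 0 := hL.ne'
      have key : 2 * (Real.pi ^ 2 * ε' / (16 * L ^ 2)) + 2 * Real.pi ^ 2 / L ^ 2 =
          (Real.pi ^ 2 * ε' / 8 + 2 * Real.pi ^ 2) / L ^ 2 := by
        field_simp
        ring
      have key2 : (2 * Real.pi / L) ^ 2 = (4 * Real.pi ^ 2) / L ^ 2 := by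
        field_simp
        ring
      rw [key, key2]
      refine div_le_div_of_nonneg_right ?_ hL2.le
      nlinarith [mul_le_mul_of_nonneg_left hε'1 (sq_nonneg Real.pi)]
    calc 2 * periodicGroundStateEnergy v N L + ENNReal.ofReal γ
        ≤ 2 * ENNReal.ofReal d + ENNReal.ofReal γ := by gcongr
      _ = ENNReal.ofReal (2 * d + γ) := by
          rw [ENNReal.ofReal_add (by positivity) hγ0.le, ENNReal.ofReal_mul zero_le_two,
            ENNReal.ofReal_ofNat]
      _ ≤ ENNReal.ofReal ((2 * Real.pi / L) ^ 2) := ENNReal.ofReal_le_ofReal h2d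
      _ ≤ kyFanTwo 0 N L := ofReal_sq_le_kyFanTwo_zero hL N
      _ ≤ kyFanTwo v N L := by
          unfold kyFanTwo
          exact iInf_mono fun Ψ₁ => iInf_mono fun Ψ₂ => iInf_mono fun _ =>
            add_le_add (periodicEnergy_mono_of_le (fun _ => bot_le) Ψ₁)
              (periodicEnergy_mono_of_le (fun _ => bot_le) Ψ₂)
  have hdd : d + d = γ * ε' / 16 := by rw [hd, hγ]; ring
  refine ⟨ENNReal.ofReal d, ENNReal.ofReal_pos.2 hd0, fun Φ Ψ hΦ hΨ => ?_⟩
  -- `Φ` is a free `(d + d)`-near-minimiser, `Ψ` a free `d`-near-minimiser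
  have hΦfree : periodicEnergy v Φ ≤ periodicGroundStateEnergy v N L + ENNReal.ofReal (γ * ε' / 16) := by
    calc periodicEnergy v Φ ≤ impurityPeriodicEnergy v 0 Φ := periodicEnergy_le_impurityPeriodicEnergy v 0 Φ
      _ ≤ impurityPeriodicGroundStateEnergy v N L 0 + ENNReal.ofReal d := hΦ
      _ ≤ ENNReal.ofReal d + ENNReal.ofReal d := add_le_add himp le_rfl
      _ = ENNReal.ofReal (γ * ε' / 16) := by rw [← ENNReal.ofReal_add hd0.le hd0.le, hdd]
      _ ≤ periodicGroundStateEnergy v N L + ENNReal.ofReal (γ * ε' / 16) := le_add_self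
  have hΨfree : periodicEnergy v Ψ ≤ periodicGroundStateEnergy v N L + ENNReal.ofReal (γ * ε' / 16) := by
    refine hΨ.trans (add_le_add le_rfl (ENNReal.ofReal_le_ofReal ?_))
    rw [← hdd]; linarith
  obtain ⟨θ, hθ⟩ := UniformGapTransfer.exists_phase_integral_norm_sub_sq_le_of_kyFanGap_explicit hv.1 hγ0
    hE hgap hε'0 Ψ Φ hΨfree hΦfree
  exact (ENNReal.ofReal_le_ofReal (by linarith)).trans (ofReal_le_sq_nnnorm_integral_of_phase Ψ Φ hθ)

/-- **Fixed-`N` endpoint fidelity, density form, every admissible `v`**: for every `N` there is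
`ρ₀(v, ε, N) > 0` such that for `0 < ρ < ρ₀`, at `L = sideLength ρ (N + 1)`, one slack serves all pinned
and all free near-minimisers (`L³ = (N+1)/ρ ≥ L₀³` for `ρ ≤ (N+1)/L₀³`). [folklore] -/
theorem endpointFidelity_fixedN_all_density :
    ∀ (v : ℝ → ℝ≥0∞), IsRepulsiveFiniteRange v →
      ∀ ε : ℝ, 0 < ε → ∀ N : ℕ, ∃ ρ₀ : ℝ, 0 < ρ₀ ∧ ∀ ρ : ℝ, 0 < ρ → ρ < ρ₀ →
        ∀ L : ℝ, L = sideLength ρ (N + 1) →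
          ∃ δ : ℝ≥0∞, 0 < δ ∧ ∀ Φ Ψ : PeriodicTrialState N L,
            impurityPeriodicEnergy v 0 Φ ≤ impurityPeriodicGroundStateEnergy v N L 0 + δ →
            periodicEnergy v Ψ ≤ periodicGroundStateEnergy v N L + δ →
            ENNReal.ofReal (1 - ε) ≤
              (‖∫ X in cellN N L, conj (Ψ.ψ X) * Φ.ψ X‖₊ : ℝ≥0∞) ^ 2 := by
  intro v hv ε hε N
  obtain ⟨L₀, hL₀, H⟩ := endpointFidelity_fixedN_all v hv ε hε N
  refine ⟨((N : ℝ) + 1) / L₀ ^ 3, by positivity, fun ρ hρ hρlt L hL => H L ?_⟩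
  rw [hL]
  unfold sideLength
  rw [show (1 / 3 : ℝ) = (3 : ℝ)⁻¹ by norm_num,
    Real.le_rpow_inv_iff_of_pos hL₀.le (by positivity) (by norm_num : (0 : ℝ) < 3),
    show (3 : ℝ) = ((3 : ℕ) : ℝ) by norm_num, Real.rpow_natCast, le_div_iff₀ hρ]
  have := (lt_div_iff₀ (by positivity : (0 : ℝ) < L₀ ^ 3)).1 hρlt
  push_cast
  linarith

/-- **The registered stub at fixed `N`, EVERY admissible `v`, PROVED.** The body of `stub_fidelityForEach`
verbatim with the quantifier order `∀ N, ∃ ρ₀` in place of `∃ ρ₀, ∀ ρ < ρ₀, ∀ᶠ N`, now without the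
integrability hypothesis of `stub_fidelityForEach_fixedN` (p165038): hard cores, hard shells and
non-integrable walls included. So over the whole admissible class the open content of the stub is exactly
the uniformity of `ρ₀` in `N`. [folklore] -/
theorem stub_fidelityForEach_fixedN_all :
    ∀ (v : ℝ → ℝ≥0∞), IsRepulsiveFiniteRange v → ∀ ε : ℝ, 0 < ε →
      ∀ N : ℕ, ∃ ρ₀ : ℝ, 0 < ρ₀ ∧ ∀ ρ : ℝ, 0 < ρ → ρ < ρ₀ →
        ∀ L : ℝ, L = sideLength ρ (N + 1) →
          periodicGroundStateEnergy v N L ≠ ⊤ →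
          impurityPeriodicGroundStateEnergy v N L 0 ≠ ⊤ →
          ∀ δ₂ : ℝ≥0∞, 0 < δ₂ → ∃ δ₁ : ℝ≥0∞, 0 < δ₁ ∧
            ∀ Φ : PeriodicTrialState N L,
              impurityPeriodicEnergy v 0 Φ ≤ impurityPeriodicGroundStateEnergy v N L 0 + δ₁ →
              ∃ Ψ : PeriodicTrialState N L,
                periodicEnergy v Ψ ≤ periodicGroundStateEnergy v N L + δ₂ ∧
                ENNReal.ofReal (1 - ε) ≤
                  (‖∫ X in cellN N L, conj (Ψ.ψ X) * Φ.ψ X‖₊ : ℝ≥0∞) ^ 2 := by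
  intro v hv ε hε N
  obtain ⟨ρ₀, hρ₀, H⟩ := endpointFidelity_fixedN_all_density v hv ε hε N
  refine ⟨ρ₀, hρ₀, fun ρ hρ hρlt L hL hEper _ δ₂ hδ₂ => ?_⟩
  obtain ⟨δ, hδ, K⟩ := H ρ hρ hρlt L hL
  refine ⟨min δ δ₂, lt_min hδ hδ₂, fun Φ hΦ => ?_⟩
  have hlt : periodicGroundStateEnergy v N L < periodicGroundStateEnergy v N L + min δ δ₂ :=
    ENNReal.lt_add_right hEper (lt_min hδ hδ₂).ne'
  obtain ⟨Ψ, hΨ⟩ := iInf_lt_iff.1 hlt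
  refine ⟨Ψ, hΨ.le.trans (add_le_add le_rfl (min_le_right _ _)), ?_⟩
  exact K Φ Ψ (hΦ.trans (add_le_add le_rfl (min_le_left _ _)))
    (hΨ.le.trans (add_le_add le_rfl (min_le_left _ _)))

/-! ### The crux body at fixed `N`, every admissible `v` -/

/-- **`CloudMomentumAtom` at fixed `N`, EVERY admissible `v`, PROVED.** The crux's body with the density
threshold allowed to depend on the particle number: for every repulsive finite-range `v` (hard cores, hard
shells, fat-Cantor `⊤`-sets, non-integrable walls included), every `ε > 0` and every `N ≥ 1` there is
`ρ₀(v, ε, N) > 0` such that for `0 < ρ < ρ₀` there is `δ > 0` with: every `δ`-near-minimiser `Φ` of the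
pinned-scatterer energy on the torus of side `L = sideLength ρ (N + 1)` has zero-total-momentum weight
`w₀(Φ) ≥ 1 − ε`. Proof: `endpointFidelity_fixedN_all_density` with `ε/2`, zero-momentum rigidity of free
near-minimisers at fixed `(N, L)` (`freeZeroMomentum_fixed`, p143762; `E^per(N) ≤ E^per(N+1) < ∞` on large
tori by `exists_periodicGroundStateEnergy_le_div_sq`) and the projection transfer (`stub_projectionTransfer`,
p144993). This removes the integrability hypothesis of `stub_cloudMomentumAtom_fixedN` (p165338): over the
whole admissible class, the crux `CloudMomentumAtom` (`∃ ρ₀ ∀ ρ < ρ₀ ∀ᶠ N`) differs from a theorem EXACTLY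
by the uniformity of `ρ₀` in `N`. [folklore] -/
theorem stub_cloudMomentumAtom_fixedN_all :
    ∀ (v : ℝ → ℝ≥0∞), IsRepulsiveFiniteRange v → ∀ ε : ℝ, 0 < ε →
      ∀ N : ℕ, 0 < N → ∃ ρ₀ : ℝ, 0 < ρ₀ ∧ ∀ ρ : ℝ, 0 < ρ → ρ < ρ₀ →
        ∃ δ : ℝ≥0∞, 0 < δ ∧
          ∀ Φ : PeriodicTrialState N (sideLength ρ (N + 1)),
            impurityPeriodicEnergy v 0 Φ ≤
                impurityPeriodicGroundStateEnergy v N (sideLength ρ (N + 1)) 0 + δ →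
              ENNReal.ofReal ((1 - ε) * sideLength ρ (N + 1) ^ 6) ≤
                ∫⁻ X in cellN N (sideLength ρ (N + 1)),
                  (‖∫ t in cell (sideLength ρ (N + 1)), Φ.ψ (X + fun _ => t)‖₊ : ℝ≥0∞) ^ 2 := by
  intro v hv ε hε N hN
  obtain ⟨ρ₀, hρ₀, H⟩ := endpointFidelity_fixedN_all_density v hv (ε / 2) (half_pos hε) N
  -- a second threshold making the free infimum finite: `E^per(N, L) ≤ E^per(N+1, L) ≤ 1/L²`
  obtain ⟨L₁, hL₁, HL₁⟩ := exists_periodicGroundStateEnergy_le_div_sq hv (N + 1) one_pos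
  refine ⟨min ρ₀ (((N : ℝ) + 1) / L₁ ^ 3), lt_min hρ₀ (by positivity), fun ρ hρ hρlt => ?_⟩
  set L : ℝ := sideLength ρ (N + 1) with hLdef
  have hL : 0 < L := by
    rw [hLdef]; unfold sideLength
    exact Real.rpow_pos_of_pos (div_pos (by exact_mod_cast Nat.succ_pos N) hρ) _
  -- `L₁ ≤ L`, hence the free infimum is finite
  have hL₁L : L₁ ≤ L := by
    have hρlt' : ρ < ((N : ℝ) + 1) / L₁ ^ 3 := hρlt.trans_le (min_le_right _ _)
    rw [hLdef]
    unfold sideLength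
    rw [show (1 / 3 : ℝ) = (3 : ℝ)⁻¹ by norm_num,
      Real.le_rpow_inv_iff_of_pos hL₁.le (by positivity) (by norm_num : (0 : ℝ) < 3),
      show (3 : ℝ) = ((3 : ℕ) : ℝ) by norm_num, Real.rpow_natCast, le_div_iff₀ hρ]
    have := (lt_div_iff₀ (by positivity : (0 : ℝ) < L₁ ^ 3)).1 hρlt'
    push_cast
    linarith
  have hE : periodicGroundStateEnergy v N L ≠ ⊤ :=
    ne_top_of_le_ne_top ENNReal.ofReal_ne_top
      ((periodicGroundStateEnergy_le_succ hv.1 N L).trans (HL₁ L hL₁L))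
  obtain ⟨δE, hδE, KE⟩ := H ρ hρ (hρlt.trans_le (min_le_left _ _)) L rfl
  obtain ⟨δZ, hδZ, KZ⟩ := freeZeroMomentum_fixed hN hL hv.1 hE (ε := ε ^ 2 / 16) (by positivity)
  refine ⟨min δE δZ, lt_min hδE hδZ, fun Φ hΦ => ?_⟩
  have hlt : periodicGroundStateEnergy v N L < periodicGroundStateEnergy v N L + min δE δZ :=
    ENNReal.lt_add_right hE (lt_min hδE hδZ).ne'
  obtain ⟨Ψ, hΨ⟩ := iInf_lt_iff.1 hlt
  have hover := KE Φ Ψ (hΦ.trans (add_le_add le_rfl (min_le_left _ _)))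
    (hΨ.le.trans (add_le_add le_rfl (min_le_left _ _)))
  have hw := KZ Ψ (hΨ.le.trans (add_le_add le_rfl (min_le_right _ _)))
  exact stub_projectionTransfer N L hL ε hε Φ Ψ hover hw

end Summit.AtomisticToContinuum.BoseEinsteinCondensation.Cruxes.CloudMomentumAtom.Birth

end
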